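import Mathlib
import HarnessLib
import Summits.HubbardSuperconductivity.HubbardSuperconductivity.Theorems.KLProgrammeKLRegimeTwoVolumeDefectTannery
import Summits.HubbardSuperconductivity.HubbardSuperconductivity.Theorems.KLProgrammeKLRegimeTwoVolumeStepMajorant

/-!
# Route `KLProgramme` — crux K3, the nested two-volume pass: THE LIMIT SPINE OF THE DEFECT TOWER (termwise limits, scale by scale)
# (cell gate-hubbard-kl, seat hubbard-kl-k3c4-p1 g9; memo VL-ROUTE-A-RADIUS-g9.md §3; replaces the linear recursion `…TwoVolumeDefectRecursion` as the spine of
# (vi) for the rate-free VL stub; `--supports` stmt-…-20440)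

Pure real analysis.  The algebraic induction (`…TwoVolumeScaleSucc.twoVolume_scale_succ_le`, one scale; iterated in the model file) bounds, at every
volume index `L`, the deep defect profile `E (j+1) (n+1) L` of scale `j+1` by the LINEAR form
`K_E·(Σ'_m w_j^{2m}·tb_j(m,L)) + K_D·(φRd_j L)⁻¹ + K_Te·Te_j L + K_T·T_j L + K_Rf·(Rf_j L)⁻¹` (`…TwoVolumeStepMajorant`, with `normV ≤ Σ'` of
`…TwoVolumeDefectTannery`), where `tb_j(m,L) = aⁿ(a·E j (2m) L + τ_j L·ND_j(2m)) + 2aⁿτ_j L·N_j(2m) + n·aⁿ(5τ_j L·N_j(2m) + 2a·Nfar_j(2m) L)`, `n = 2m−1`,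
is the transfer bound (`…SubstitutionGluingDeepPin` §2) fed by the scale-`j` profile.  This file proves that such a tower of profiles tends to `0` termwise
at every scale `j ≤ n⋆`, given: the scale-`0` profile → 0 termwise; L-uniform one-volume bounds (domination); the sources `τ_j, Nfar_j, Te_j, T_j → 0` and
`φRd_j, Rf_j → ∞`; and summability of the dominating series at the weight `(e²(κ_j+ρ_j))^{2m}` (the one-volume smallness of the STEP).  TANNERY per scale;
no rate, no amplification constant.

* `transferBound_le_of_le` — the transfer bound is monotone in `(E, τ, Nfar)`;
* **`tendsto_defectTower_zero`** — the displayed statement.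

No definition (the recursion is a hypothesis on the user's profile `E : scale → degree → volume → ℝ`).
-/

noncomputable section

namespace Summit.HubbardSuperconductivity.HubbardSuperconductivity.Theorems.TwoVolumeDefect

set_option linter.dupNamespace false -- summit = problem name (single-conjunct summit), D-0017

open Finset Filter Topology Literature.MathematicalPhysics.QuantumLattice

/-- **The transfer bound is monotone** in the defect size, the substitution tail and the far profile (all data nonnegative). [folklore] -/
theorem transferBound_le_of_le {a N ND E E' τ τ' Nf Nf' : ℝ} (n : ℕ) (ha : 0 ≤ a) (hN : 0 ≤ N) (hND : 0 ≤ ND)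
    (hE : E ≤ E') (hτ : τ ≤ τ') (hNf : Nf ≤ Nf') :
    a ^ n * (a * E + τ * ND) + (2 * a ^ n * τ * N + n * a ^ n * (5 * τ * N + 2 * a * Nf)) ≤
      a ^ n * (a * E' + τ' * ND) + (2 * a ^ n * τ' * N + n * a ^ n * (5 * τ' * N + 2 * a * Nf')) := by
  have han : 0 ≤ a ^ n := pow_nonneg ha n
  gcongr

/-- The transfer bound is nonnegative (all data nonnegative). [folklore] -/
theorem transferBound_nonneg {a N ND E τ Nf : ℝ} (n : ℕ) (ha : 0 ≤ a) (hN : 0 ≤ N) (hND : 0 ≤ ND) (hE0 : 0 ≤ E) (hτ0 : 0 ≤ τ)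
    (hNf0 : 0 ≤ Nf) : 0 ≤ a ^ n * (a * E + τ * ND) + (2 * a ^ n * τ * N + n * a ^ n * (5 * τ * N + 2 * a * Nf)) := by
  have han : 0 ≤ a ^ n := pow_nonneg ha n
  positivity

/-- **THE DEFECT TOWER TENDS TO ZERO TERMWISE, SCALE BY SCALE.**  Profiles `E j k L ≥ 0` (scale `j`, raw degree `k`, volume index `L`) with: scale `0` → 0
termwise; degree `0` → 0 at every scale; L-uniform bounds `E j k L ≤ Ē j k`; sources `τ_j, Nfar_j → 0` (bounded by `τ̄_j, N̄far_j`), `Te_j, T_j → 0`,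
`φRd_j, Rf_j → +∞`; the dominating transfer series summable at the weight `(e²(κ_j+ρ_j))^{2m}`; and the recursion «`E (j+1) (n+1) L ≤` the STEP's linear form
in `Σ'_m (e²(κ_j+ρ_j))^{2m}·tb_j(m,L)` and the four sources» eventually in `L`, for `j < n⋆`.  THEN `E j k L → 0` for every `j ≤ n⋆` and every `k`.
[folklore: Tannery's theorem per scale] -/
theorem tendsto_defectTower_zero (nstar : ℕ) (E : ℕ → ℕ → ℕ → ℝ) (Ebar N ND : ℕ → ℕ → ℝ) (a τbar : ℕ → ℝ) (Nfarbar : ℕ → ℕ → ℝ)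
    (τ Te T φRd Rf : ℕ → ℕ → ℝ) (Nfar : ℕ → ℕ → ℕ → ℝ) (KE KD KTe KT KRf : ℕ → ℕ → ℝ) (κ ρ : ℕ → ℝ)
    (hκ : ∀ j, 0 ≤ κ j) (hρ : ∀ j, 0 ≤ ρ j) (ha : ∀ j, 0 ≤ a j) (hN : ∀ j k, 0 ≤ N j k) (hND : ∀ j k, 0 ≤ ND j k)
    (hEnn : ∀ j k L, 0 ≤ E j k L) (hEbd : ∀ j k L, E j k L ≤ Ebar j k)
    (hτnn : ∀ j L, 0 ≤ τ j L) (hτbd : ∀ j L, τ j L ≤ τbar j) (hτ : ∀ j, Tendsto (τ j) atTop (𝓝 0))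
    (hNfnn : ∀ j k L, 0 ≤ Nfar j k L) (hNfbd : ∀ j k L, Nfar j k L ≤ Nfarbar j k) (hNf : ∀ j k, Tendsto (Nfar j k) atTop (𝓝 0))
    (hTe : ∀ j, Tendsto (Te j) atTop (𝓝 0)) (hT : ∀ j, Tendsto (T j) atTop (𝓝 0))
    (hφ : ∀ j, Tendsto (φRd j) atTop atTop) (hRf : ∀ j, Tendsto (Rf j) atTop atTop)
    (hsum : ∀ j, Summable fun m : ℕ => (Real.exp 2 * (κ j + ρ j)) ^ (2 * m) *
      (a j ^ (2 * m - 1) * (a j * Ebar j (2 * m) + τbar j * ND j (2 * m)) +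
        (2 * a j ^ (2 * m - 1) * τbar j * N j (2 * m) + ((2 * m - 1 : ℕ) : ℝ) * a j ^ (2 * m - 1) * (5 * τbar j * N j (2 * m) + 2 * a j * Nfarbar j (2 * m)))))
    (h0 : ∀ k, Tendsto (E 0 k) atTop (𝓝 0)) (hdeg0 : ∀ j, Tendsto (E (j + 1) 0) atTop (𝓝 0))
    (hrec : ∀ j, j < nstar → ∀ n : ℕ, ∀ᶠ L in atTop, E (j + 1) (n + 1) L ≤
      KE j n * (∑' m : ℕ, (Real.exp 2 * (κ j + ρ j)) ^ (2 * m) *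
          (a j ^ (2 * m - 1) * (a j * E j (2 * m) L + τ j L * ND j (2 * m)) +
            (2 * a j ^ (2 * m - 1) * τ j L * N j (2 * m) +
              ((2 * m - 1 : ℕ) : ℝ) * a j ^ (2 * m - 1) * (5 * τ j L * N j (2 * m) + 2 * a j * Nfar j (2 * m) L)))) +
        KD j n * (φRd j L)⁻¹ + KTe j n * Te j L + KT j n * T j L + KRf j n * (Rf j L)⁻¹) :
    ∀ j, j ≤ nstar → ∀ k, Tendsto (E j k) atTop (𝓝 0) := by
  intro j
  induction j with
  | zero => exact fun _ k => h0 k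
  | succ j ih =>
    intro hj k
    have ihj : ∀ k, Tendsto (E j k) atTop (𝓝 0) := ih (Nat.le_of_succ_le hj)
    rcases k with _ | n
    · exact hdeg0 j
    -- the transferred profile: termwise → 0, dominated
    have htb : ∀ m : ℕ, Tendsto (fun L => a j ^ (2 * m - 1) * (a j * E j (2 * m) L + τ j L * ND j (2 * m)) +
        (2 * a j ^ (2 * m - 1) * τ j L * N j (2 * m) +
          ((2 * m - 1 : ℕ) : ℝ) * a j ^ (2 * m - 1) * (5 * τ j L * N j (2 * m) + 2 * a j * Nfar j (2 * m) L))) atTop (𝓝 0) :=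
      fun m => tendsto_transfer_rhs_zero (a j) (N j (2 * m)) (ND j (2 * m)) (2 * m - 1) (ihj (2 * m)) (hτ j) (hNf j (2 * m))
    have hdom : ∀ᶠ L in atTop, ∀ m : ℕ,
        0 ≤ a j ^ (2 * m - 1) * (a j * E j (2 * m) L + τ j L * ND j (2 * m)) +
            (2 * a j ^ (2 * m - 1) * τ j L * N j (2 * m) +
              ((2 * m - 1 : ℕ) : ℝ) * a j ^ (2 * m - 1) * (5 * τ j L * N j (2 * m) + 2 * a j * Nfar j (2 * m) L)) ∧
          a j ^ (2 * m - 1) * (a j * E j (2 * m) L + τ j L * ND j (2 * m)) +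
            (2 * a j ^ (2 * m - 1) * τ j L * N j (2 * m) +
              ((2 * m - 1 : ℕ) : ℝ) * a j ^ (2 * m - 1) * (5 * τ j L * N j (2 * m) + 2 * a j * Nfar j (2 * m) L)) ≤
          a j ^ (2 * m - 1) * (a j * Ebar j (2 * m) + τbar j * ND j (2 * m)) +
            (2 * a j ^ (2 * m - 1) * τbar j * N j (2 * m) +
              ((2 * m - 1 : ℕ) : ℝ) * a j ^ (2 * m - 1) * (5 * τbar j * N j (2 * m) + 2 * a j * Nfarbar j (2 * m))) :=
      Eventually.of_forall fun L m =>
        ⟨transferBound_nonneg (2 * m - 1) (ha j) (hN j _) (hND j _) (hEnn j _ L) (hτnn j L) (hNfnn j _ L),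
          transferBound_le_of_le (2 * m - 1) (ha j) (hN j _) (hND j _) (hEbd j _ L) (hτbd j L) (hNfbd j _ L)⟩
    have hS := tendsto_tsum_normVWeight_of_dominated (hκ j) (hρ j) _ _ hdom (hsum j) htb
    have hlin := tendsto_linear₅_zero (KE j n) (KD j n) (KTe j n) (KT j n) (KRf j n) hS (hTe j) (hT j) (hφ j) (hRf j)
    refine squeeze_zero' (Eventually.of_forall fun L => hEnn (j + 1) (n + 1) L) (hrec j hj n) ?_
    simpa using hlin

end Summit.HubbardSuperconductivity.HubbardSuperconductivity.Theorems.TwoVolumeDefect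

end
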